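import Literature.AlgebraicGeometry.Motives.HodgeTensorPowerProofs
import Literature.AlgebraicGeometry.Motives.HodgeTensorDualOpposedProofs
import Literature.AlgebraicGeometry.Motives.MumfordTateInvariantsDerivation
import HarnessLib

/-!
# Complexification of the tensor spaces `T^{a,b} V` (Mumford–Tate invariants, step 4)

For a finite-dimensional `ℚ`-vector space `V` with complexification `V_ℂ = ℂ ⊗_ℚ V` we build the
comparison ISOMORPHISM
`hodgeTensorSpaceBaseChange V a b : ℂ ⊗_ℚ T^{a,b} V ≃ₗ[ℂ] T^{a,b}_ℂ V_ℂ`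
(`T^{a,b} V = hodgeTensorSpace V a b`, `T^{a,b}_ℂ V_ℂ = hodgeTensorSpaceOver ℂ V_ℂ a b`), assembled
from the comparison maps of `HodgeTensor.lean` (`tensorBaseChange`, `piTensorBaseChange`,
`dualBaseChange`, bijective for finite-dimensional `V` by `piTensorBaseChange_bijective`,
`dualBaseChange_bijective`), and we prove:

* `hodgeTensorSpaceBaseChange_one_tmul`: on `1 ⊗ t` it is the comparison map
  `tensorSpaceToBaseChange ℂ V a b` of `EtaleTate.lean` (so it extends it `ℂ`-linearly);
* naturality for the action of `GL(V)` (`hodgeTensorSpaceBaseChange_tensorSpaceAct`) and for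
  the derivation action of `End(V)` (`hodgeTensorSpaceBaseChange_tensorDerivation`): extension
  of scalars commutes with the actions on tensor spaces (Deligne, *Hodge cycles on abelian
  varieties*, LNM 900, I §3.1);
* descent: `v ↦ 1 ⊗ v` is injective (`one_tmul_injective`), membership of a rational vector in
  the complexification of a rational subspace descends (`mem_of_one_tmul_mem_baseChange`).

## References

* P. Deligne, *Hodge cycles on abelian varieties* (notes by J. S. Milne), LNM 900 (1982), I §3.
-/

noncomputable section

open scoped TensorProduct PiTensorProduct

namespace Literature.AlgebraicGeometry.Motives

universe u v

/-! ### Descent of injectivity and membership along `ℚ → ℂ` -/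

section Descent

variable {M : Type u} [AddCommGroup M] [Module ℚ M]

/-- **`m ↦ 1 ⊗ m : M → ℂ ⊗_ℚ M` is injective** (`ℂ` is free over `ℚ`; concretely, a `ℚ`-linear
retraction `r : ℂ → ℚ` of the inclusion gives the retraction `r ⊗ id`). [folklore] -/
theorem one_tmul_injective : Function.Injective fun m : M => (1 : ℂ) ⊗ₜ[ℚ] m := by
  obtain ⟨r, hr⟩ := LinearMap.exists_leftInverse_of_injective (Algebra.linearMap ℚ ℂ)
    (LinearMap.ker_eq_bot.2 (algebraMap ℚ ℂ).injective)
  intro m m' h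
  have h' := congrArg (fun x => TensorProduct.lid ℚ M (r.rTensor M x)) h
  have hr1 : r 1 = 1 := by simpa using LinearMap.congr_fun hr 1
  simpa [LinearMap.rTensor_tmul, hr1] using h'

/-- **Descent of membership**: if `1 ⊗ m` lies in the complexification `p_ℂ` of a rational
subspace `p`, then `m ∈ p` (pass to the quotient `M ⧸ p` and use `one_tmul_injective`). [folklore] -/
theorem mem_of_one_tmul_mem_baseChange (p : Submodule ℚ M) {m : M}
    (hm : (1 : ℂ) ⊗ₜ[ℚ] m ∈ p.baseChange ℂ) : m ∈ p := by
  obtain ⟨x, hx⟩ := hm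
  have h0 : p.mkQ.comp p.subtype = 0 :=
    LinearMap.range_le_ker_iff.1 (by rw [Submodule.range_subtype, Submodule.ker_mkQ])
  have h1 : (p.mkQ.baseChange ℂ) ((1 : ℂ) ⊗ₜ[ℚ] m) = 0 := by
    rw [← hx, ← LinearMap.comp_apply, ← LinearMap.baseChange_comp, h0,
      LinearMap.baseChange_zero, LinearMap.zero_apply]
  rw [LinearMap.baseChange_tmul, Submodule.mkQ_apply, ← TensorProduct.tmul_zero (M ⧸ p) (1 : ℂ)] at h1
  rw [← Submodule.Quotient.mk_eq_zero]
  exact one_tmul_injective h1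

end Descent

/-! ### The comparison isomorphism `ℂ ⊗ T^{a,b} V ≃ T^{a,b}_ℂ V_ℂ` -/

section Complexification

variable (V : Type u) [AddCommGroup V] [Module ℚ V]

/-- The comparison isomorphism `ℂ ⊗ V^{⊗ι} ≃ₗ[ℂ] (V_ℂ)^{⊗ι}` for a finite index type
(`HodgeStructure.piTensorBaseChange`, bijective by `piTensorBaseChange_bijective`). [folklore] -/
def piTensorBaseChangeEquiv (ι : Type v) [Finite ι] :
    ℂ ⊗[ℚ] (⨂[ℚ] _ : ι, V) ≃ₗ[ℂ] ⨂[ℂ] _ : ι, (ℂ ⊗[ℚ] V) :=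
  LinearEquiv.ofBijective (HodgeStructure.piTensorBaseChange V ι)
    (HodgeStructure.piTensorBaseChange_bijective V ι)

/-- `piTensorBaseChangeEquiv` is `piTensorBaseChange`. [folklore] -/
theorem piTensorBaseChangeEquiv_apply {ι : Type v} [Finite ι] (x : ℂ ⊗[ℚ] (⨂[ℚ] _ : ι, V)) :
    piTensorBaseChangeEquiv V ι x = HodgeStructure.piTensorBaseChange V ι x :=
  rfl

/-- On `1 ⊗ φ` the comparison map `dualBaseChange` is Mathlib's `Module.Dual.baseChange`.
[folklore] -/
theorem dualBaseChange_one_tmul (φ : Module.Dual ℚ V) :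
    HodgeStructure.dualBaseChange V ((1 : ℂ) ⊗ₜ[ℚ] φ) = Module.Dual.baseChange ℂ φ := by
  refine TensorProduct.AlgebraTensorModule.ext fun d v => ?_
  rw [HodgeStructure.dualBaseChange_tmul_tmul, Module.Dual.baseChange_apply_tmul, one_mul]

/-- The base change of `φ ∘ X` is `φ_ℂ ∘ X_ℂ`. [folklore] -/
theorem dualBaseChange_comp (φ : Module.Dual ℚ V) (X : Module.End ℚ V) :
    Module.Dual.baseChange ℂ (φ ∘ₗ X) = (Module.Dual.baseChange ℂ φ) ∘ₗ X.baseChange ℂ := by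
  refine TensorProduct.AlgebraTensorModule.ext fun d v => ?_
  simp [Module.Dual.baseChange_apply_tmul, LinearMap.baseChange_tmul]

variable [Module.Finite ℚ V]

/-- The comparison isomorphism `ℂ ⊗ V^∨ ≃ₗ[ℂ] (V_ℂ)^∨` for `V` finite-dimensional
(`HodgeStructure.dualBaseChange`, bijective by `dualBaseChange_bijective`). [folklore] -/
def dualBaseChangeEquiv : ℂ ⊗[ℚ] Module.Dual ℚ V ≃ₗ[ℂ] Module.Dual ℂ (ℂ ⊗[ℚ] V) :=
  LinearEquiv.ofBijective (HodgeStructure.dualBaseChange V) HodgeStructure.dualBaseChange_bijective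

/-- `dualBaseChangeEquiv` is `dualBaseChange`. [folklore] -/
theorem dualBaseChangeEquiv_apply (ξ : ℂ ⊗[ℚ] Module.Dual ℚ V) :
    dualBaseChangeEquiv V ξ = HodgeStructure.dualBaseChange V ξ :=
  rfl

/-- **The comparison isomorphism** `ι : ℂ ⊗_ℚ T^{a,b} V ≃ₗ[ℂ] T^{a,b}_ℂ (ℂ ⊗_ℚ V)` for `V`
finite-dimensional: `ℂ ⊗ (V^{⊗a} ⊗ V^{∨⊗b}) ≃ (ℂ ⊗ V^{⊗a}) ⊗_ℂ (ℂ ⊗ V^{∨⊗b})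
≃ V_ℂ^{⊗a} ⊗_ℂ (ℂ ⊗ V^∨)^{⊗b} ≃ V_ℂ^{⊗a} ⊗_ℂ (V_ℂ^∨)^{⊗b}` (extension of scalars of the tensor
spaces of Deligne, LNM 900, I §3.1). [folklore] -/
def hodgeTensorSpaceBaseChange (a b : ℕ) :
    ℂ ⊗[ℚ] hodgeTensorSpace V a b ≃ₗ[ℂ] hodgeTensorSpaceOver ℂ (ℂ ⊗[ℚ] V) a b :=
  (HodgeStructure.tensorBaseChange (⨂[ℚ]^a V) (⨂[ℚ]^b (Module.Dual ℚ V))).trans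
    (TensorProduct.congr (piTensorBaseChangeEquiv V (Fin a))
      ((piTensorBaseChangeEquiv (Module.Dual ℚ V) (Fin b)).trans
        (PiTensorProduct.congr fun _ => dualBaseChangeEquiv V)))

/-- The comparison isomorphism on `c ⊗ ((⊗ vₖ) ⊗ (⊗ φₗ))`: it is
`c • ((⊗ (1 ⊗ vₖ)) ⊗ (⊗ (φₗ)_ℂ))`. [folklore] -/
theorem hodgeTensorSpaceBaseChange_tmul_tprod {a b : ℕ} (c : ℂ) (v : Fin a → V)
    (φ : Fin b → Module.Dual ℚ V) :
    hodgeTensorSpaceBaseChange V a b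
        (c ⊗ₜ[ℚ] (PiTensorProduct.tprod ℚ v ⊗ₜ[ℚ] PiTensorProduct.tprod ℚ φ)) =
      c • ((PiTensorProduct.tprod ℂ fun k => (1 : ℂ) ⊗ₜ[ℚ] v k) ⊗ₜ[ℂ]
        PiTensorProduct.tprod ℂ fun l => Module.Dual.baseChange ℂ (φ l)) := by
  simp only [hodgeTensorSpaceBaseChange, LinearEquiv.trans_apply,
    HodgeStructure.tensorBaseChange_tmul, TensorProduct.congr_tmul, piTensorBaseChangeEquiv_apply,
    HodgeStructure.piTensorBaseChange_tmul_tprod, one_smul, PiTensorProduct.congr_tprod,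
    dualBaseChangeEquiv_apply, HodgeStructure.ofRat_apply, dualBaseChange_one_tmul,
    TensorProduct.smul_tmul']

/-- **On `1 ⊗ t` the comparison isomorphism is the comparison map `tensorSpaceToBaseChange ℂ` of
`EtaleTate.lean`.** [folklore] -/
theorem hodgeTensorSpaceBaseChange_one_tmul {a b : ℕ} (t : hodgeTensorSpace V a b) :
    hodgeTensorSpaceBaseChange V a b ((1 : ℂ) ⊗ₜ[ℚ] t) = tensorSpaceToBaseChange ℂ V a b t := by
  suffices h : ((hodgeTensorSpaceBaseChange V a b).toLinearMap.restrictScalars ℚ) ∘ₗ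
      TensorProduct.mk ℚ ℂ (hodgeTensorSpace V a b) 1 = tensorSpaceToBaseChange ℂ V a b from
    LinearMap.congr_fun h t
  ext v φ
  simp [hodgeTensorSpaceBaseChange_tmul_tprod]

/-- The comparison isomorphism on `c ⊗ t`: `ι (c ⊗ t) = c • tensorSpaceToBaseChange ℂ V a b t`.
[folklore] -/
theorem hodgeTensorSpaceBaseChange_tmul {a b : ℕ} (c : ℂ) (t : hodgeTensorSpace V a b) :
    hodgeTensorSpaceBaseChange V a b (c ⊗ₜ[ℚ] t) = c • tensorSpaceToBaseChange ℂ V a b t := by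
  rw [← hodgeTensorSpaceBaseChange_one_tmul, ← map_smul, TensorProduct.smul_tmul', smul_eq_mul,
    mul_one]

/-- `t ↦ ι (1 ⊗ t)` is injective (`ι` bijective, `t ↦ 1 ⊗ t` injective). [folklore] -/
theorem tensorSpaceToBaseChange_injective (a b : ℕ) :
    Function.Injective (tensorSpaceToBaseChange ℂ V a b) := by
  intro t t' h
  rw [← hodgeTensorSpaceBaseChange_one_tmul, ← hodgeTensorSpaceBaseChange_one_tmul] at h
  exact one_tmul_injective ((hodgeTensorSpaceBaseChange V a b).injective h)

/-! ### Naturality for the group action and for the derivation action -/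

/-- **Naturality for `GL(V)`**: `ι (1 ⊗ (g · t)) = (1 ⊗ g) · ι (1 ⊗ t)`, extended `ℂ`-linearly:
the comparison isomorphism intertwines the base change of `tensorSpaceAct g` with
`tensorSpaceActOver (g_ℂ)` (Deligne, LNM 900, I §3.1). [folklore] -/
theorem hodgeTensorSpaceBaseChange_tensorSpaceAct {a b : ℕ} (g : V ≃ₗ[ℚ] V)
    (x : ℂ ⊗[ℚ] hodgeTensorSpace V a b) :
    hodgeTensorSpaceBaseChange V a b
        (((tensorSpaceAct (a := a) (b := b) g).toLinearMap).baseChange ℂ x) =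
      tensorSpaceActOver (g.baseChange ℚ ℂ V V) (hodgeTensorSpaceBaseChange V a b x) := by
  induction x using TensorProduct.induction_on with
  | zero => simp
  | tmul c t =>
    rw [LinearMap.baseChange_tmul, LinearEquiv.coe_coe, hodgeTensorSpaceBaseChange_tmul,
      hodgeTensorSpaceBaseChange_tmul, map_smul, tensorSpaceToBaseChange_tensorSpaceAct]
  | add x y hx hy => rw [map_add, map_add, hx, hy, map_add, map_add]

/-- **Naturality for the derivation action**: the comparison isomorphism intertwines the base
change of `ρ(X) = tensorDerivation a b X` with `ρ(X_ℂ)` on `T^{a,b}_ℂ V_ℂ` (extension of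
scalars commutes with the infinitesimal action; Deligne, LNM 900, I §3.1). [folklore] -/
theorem hodgeTensorSpaceBaseChange_tensorDerivation {a b : ℕ} (X : Module.End ℚ V)
    (x : ℂ ⊗[ℚ] hodgeTensorSpace V a b) :
    hodgeTensorSpaceBaseChange V a b ((tensorDerivation a b X).baseChange ℂ x) =
      tensorDerivation a b (X.baseChange ℂ) (hodgeTensorSpaceBaseChange V a b x) := by
  -- the two `ℚ`-linear maps `t ↦ ι (1 ⊗ ρ(X) t)` and `t ↦ ρ(X_ℂ) (ι (1 ⊗ t))` agree
  have key : ((hodgeTensorSpaceBaseChange V a b).toLinearMap.restrictScalars ℚ) ∘ₗ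
      TensorProduct.mk ℚ ℂ (hodgeTensorSpace V a b) 1 ∘ₗ tensorDerivation a b X =
      ((tensorDerivation a b (X.baseChange ℂ)).restrictScalars ℚ) ∘ₗ
        (((hodgeTensorSpaceBaseChange V a b).toLinearMap.restrictScalars ℚ) ∘ₗ
          TensorProduct.mk ℚ ℂ (hodgeTensorSpace V a b) 1) := by
    ext v φ
    simp only [LinearMap.coe_comp, Function.comp_apply, LinearMap.compMultilinearMap_apply,
      TensorProduct.AlgebraTensorModule.curry_apply, TensorProduct.curry_apply,
      LinearMap.coe_restrictScalars, TensorProduct.mk_apply, LinearEquiv.coe_coe,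
      tensorDerivation_tmul_tprod, map_sub, TensorProduct.sum_tmul, TensorProduct.tmul_sum,
      map_sum, hodgeTensorSpaceBaseChange_tmul_tprod, one_smul]
    congr 1
    · refine Finset.sum_congr rfl fun k _ => ?_
      congr 1
      congr 1
      ext i
      rw [Function.apply_update (fun _ (w : V) => (1 : ℂ) ⊗ₜ[ℚ] w) v k (X (v k)) i,
        LinearMap.baseChange_tmul]
    · refine Finset.sum_congr rfl fun l _ => ?_
      congr 1
      congr 1
      ext j
      rw [Function.apply_update (fun _ (ψ : Module.Dual ℚ V) => Module.Dual.baseChange ℂ ψ) φ l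
        ((φ l).comp X) j, dualBaseChange_comp]
  induction x using TensorProduct.induction_on with
  | zero => simp
  | tmul c t =>
    have h := LinearMap.congr_fun key t
    simp only [LinearMap.coe_comp, Function.comp_apply, LinearMap.coe_restrictScalars,
      TensorProduct.mk_apply, LinearEquiv.coe_coe] at h
    rw [LinearMap.baseChange_tmul, hodgeTensorSpaceBaseChange_tmul, hodgeTensorSpaceBaseChange_tmul,
      map_smul, ← hodgeTensorSpaceBaseChange_one_tmul, ← hodgeTensorSpaceBaseChange_one_tmul, h]
  | add x y hx hy => rw [map_add, map_add, hx, hy, map_add, map_add]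

/-- Iterated naturality: powers of the derivation action. [folklore] -/
theorem hodgeTensorSpaceBaseChange_tensorDerivation_pow {a b : ℕ} (X : Module.End ℚ V) (k : ℕ)
    (t : hodgeTensorSpace V a b) :
    hodgeTensorSpaceBaseChange V a b ((1 : ℂ) ⊗ₜ[ℚ] ((tensorDerivation a b X ^ k) t)) =
      (tensorDerivation a b (X.baseChange ℂ) ^ k) (hodgeTensorSpaceBaseChange V a b ((1 : ℂ) ⊗ₜ[ℚ] t)) := by
  induction k generalizing t with
  | zero => simp
  | succ k ih =>
    rw [pow_succ, Module.End.mul_apply, ih, pow_succ, Module.End.mul_apply,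
      ← hodgeTensorSpaceBaseChange_tensorDerivation, LinearMap.baseChange_tmul]

/-! ### Complexified subspaces -/

/-- The complexification `W_ℂ ⊆ T^{a,b}_ℂ V_ℂ` of a rational subspace `W ⊆ T^{a,b} V`: the image
under the comparison isomorphism of `ℂ ⊗ W`. [folklore] -/
def subspaceBaseChange {a b : ℕ} (W : Submodule ℚ (hodgeTensorSpace V a b)) :
    Submodule ℂ (hodgeTensorSpaceOver ℂ (ℂ ⊗[ℚ] V) a b) :=
  (W.baseChange ℂ).map (hodgeTensorSpaceBaseChange V a b).toLinearMap

/-- `W_ℂ` is the `ℂ`-span of the `ι (1 ⊗ w)`, `w ∈ W`. [folklore] -/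
theorem subspaceBaseChange_eq_span {a b : ℕ} (W : Submodule ℚ (hodgeTensorSpace V a b)) :
    subspaceBaseChange V W =
      Submodule.span ℂ (tensorSpaceToBaseChange ℂ V a b '' (W : Set (hodgeTensorSpace V a b))) := by
  rw [subspaceBaseChange, Submodule.baseChange_eq_span, Submodule.map_span, Submodule.map_coe,
    ← Set.image_comp]
  congr 1
  refine Set.image_congr fun w _ => ?_
  simp [hodgeTensorSpaceBaseChange_one_tmul]

/-- Rational vectors of `W` complexify into `W_ℂ`. [folklore] -/
theorem tensorSpaceToBaseChange_mem_subspaceBaseChange {a b : ℕ}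
    (W : Submodule ℚ (hodgeTensorSpace V a b)) {w : hodgeTensorSpace V a b} (hw : w ∈ W) :
    tensorSpaceToBaseChange ℂ V a b w ∈ subspaceBaseChange V W := by
  rw [subspaceBaseChange_eq_span]
  exact Submodule.subset_span ⟨w, hw, rfl⟩

/-- **Descent for subspaces of tensor spaces**: a rational tensor whose complexification lies in
`W_ℂ` lies in `W`. [folklore] -/
theorem mem_of_tensorSpaceToBaseChange_mem_subspaceBaseChange {a b : ℕ}
    (W : Submodule ℚ (hodgeTensorSpace V a b)) {t : hodgeTensorSpace V a b}
    (ht : tensorSpaceToBaseChange ℂ V a b t ∈ subspaceBaseChange V W) : t ∈ W := by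
  refine mem_of_one_tmul_mem_baseChange W ?_
  obtain ⟨x, hx, hxt⟩ := ht
  rw [← hodgeTensorSpaceBaseChange_one_tmul, LinearEquiv.coe_coe,
    (hodgeTensorSpaceBaseChange V a b).injective.eq_iff] at hxt
  rwa [← hxt]

/-- `W_ℂ` is stable under `ρ(X_ℂ)` when `W` is stable under `ρ(X)`. [folklore] -/
theorem tensorDerivation_mem_subspaceBaseChange {a b : ℕ} (W : Submodule ℚ (hodgeTensorSpace V a b))
    {X : Module.End ℚ V} (hX : ∀ w ∈ W, tensorDerivation a b X w ∈ W)
    {s : hodgeTensorSpaceOver ℂ (ℂ ⊗[ℚ] V) a b} (hs : s ∈ subspaceBaseChange V W) :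
    tensorDerivation a b (X.baseChange ℂ) s ∈ subspaceBaseChange V W := by
  rw [subspaceBaseChange_eq_span] at hs ⊢
  induction hs using Submodule.span_induction with
  | mem x hx =>
    obtain ⟨w, hw, rfl⟩ := hx
    rw [← hodgeTensorSpaceBaseChange_one_tmul, ← hodgeTensorSpaceBaseChange_tensorDerivation,
      LinearMap.baseChange_tmul, hodgeTensorSpaceBaseChange_one_tmul]
    exact Submodule.subset_span ⟨_, hX w hw, rfl⟩
  | zero => simp
  | add x y _ _ hx hy =>
    rw [map_add]
    exact Submodule.add_mem _ hx hy
  | smul c x _ hx =>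
    rw [map_smul]
    exact Submodule.smul_mem _ c hx

/-- **Descent of stability**: if `W_ℂ` is stable under `ρ(X_ℂ)` then `W` is stable under `ρ(X)`.
[folklore] -/
theorem tensorDerivation_mem_of_subspaceBaseChange {a b : ℕ} (W : Submodule ℚ (hodgeTensorSpace V a b))
    {X : Module.End ℚ V}
    (hX : ∀ s ∈ subspaceBaseChange V W, tensorDerivation a b (X.baseChange ℂ) s ∈ subspaceBaseChange V W)
    {w : hodgeTensorSpace V a b} (hw : w ∈ W) : tensorDerivation a b X w ∈ W := by
  refine mem_of_tensorSpaceToBaseChange_mem_subspaceBaseChange V W ?_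
  have h := hX _ (tensorSpaceToBaseChange_mem_subspaceBaseChange V W hw)
  rwa [← hodgeTensorSpaceBaseChange_one_tmul, ← hodgeTensorSpaceBaseChange_tensorDerivation,
    LinearMap.baseChange_tmul, hodgeTensorSpaceBaseChange_one_tmul] at h

end Complexification

end Literature.AlgebraicGeometry.Motives

end
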